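import Mathlib.Algebra.Polynomial.FieldDivision
import Mathlib.Algebra.MvPolynomial.PDeriv
import Mathlib.RingTheory.Polynomial.Basic
import HarnessLib

/-!
# Guo–Kumar–Saptharishi–Solomon 2019, §3 Claim 23: passing to the non-degenerate derivative

Cell `val-lit`, seat t19 (literature-prover); groundwork for the discharge programme of
`GKSS2019_mainThm` (v2, erratum A34) along the printed proof of [GKSS19, §3]. THEOREM-ONLY (no
definitions, no named facts); nothing here bears on `VP ≠ VNP`, which is NOT proved.

Source: Z. Guo, M. Kumar, R. Saptharishi, N. Solomon, *Derandomization from algebraic hardness*,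
SIAM J. Comput. 51 (2022) = arXiv:1905.00091 [GuoKumarSaptharishiSolomon2019], §3 "Preprocessing
the circuit", Claim 23 with its proof (held text `paper:arxiv-1905.00091`, p0011.txt:L14–L40).

## What is here

Printed Claim 23: for the minimal nonzero `C` with `C ∘ G_P = 0`, "there is some `i ≥ 0` such that
`∂_{x_n^i}(C) ∘ G_P = 0` and `∂_{x_n^{i+1}}(C) ∘ G_P ≠ 0`", proved in Case 2 (`Ĉ ≠ 0`, where
`Ĉ(x_n) = C(g_0, …, g_{n-1}, x_n) ∈ F(y, z)[x_n]`) from "if `(∂_{x_n^i} Ĉ)(g_n) = 0` for all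
`0 ≤ i ≤ t` then `(x_n - g_n)^{t+1}` divides `Ĉ`". We prove exactly this Case 2, over an arbitrary
commutative domain `S` of characteristic zero containing the field of constants (in the
application `S = F[z, y]`), with Mathlib's `rootMultiplicity` playing the role of "the largest `e`
such that `(x_n - g_n)^e` divides `Ĉ`":

* `aeval_keepVar_pderiv` — `Ĉ` commutes with `∂_{x_m}`: substituting `g_i` for `x_i (i ≠ m)` and
  keeping `x_m` as the polynomial variable sends `∂_{x_m} C` to the formal derivative of `Ĉ`;
* `eval_aeval_keepVar` — `Ĉ(g_m) = C(g_0, …, g_m) = C ∘ G`;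
* **`claim23`** — if `C ∘ G = 0` and `Ĉ ≠ 0` then for `i := rootMultiplicity - 1`:
  `∂_{x_m^i}(C) ∘ G = 0` and `∂_{x_m^{i+1}}(C) ∘ G ≠ 0`.

Case 1 of the printed proof (`Ĉ = 0`: substitute a constant for `x_n` and recurse on the number of
variables) is the minimality bookkeeping of the main induction and is not part of this file.

## References
* [GuoKumarSaptharishiSolomon2019] arXiv:1905.00091, Claim 23 and proof (p0011.txt:L14–40).
-/

noncomputable section

open MvPolynomial

namespace Literature.Computability.AlgebraicComplexity

namespace GKSS2019

universe u v w

variable {F : Type u} [Field F] {S : Type v} [CommRing S] [Algebra F S] {τ : Type w} [DecidableEq τ]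

/-- The substitution `x_i ↦ g_i (i ≠ m)`, `x_m ↦ X` into `S[X]` ("`Ĉ(x_n) = C(g_0, …, g_{n-1}, x_n)`
… as an element of `F(y,z)[x_n]`"). We write it inline as
`aeval (fun i => if i = m then Polynomial.X else Polynomial.C (G i))`.
`∂_{x_m}` on `C` becomes the formal derivative on `Ĉ`.
[cite: GuoKumarSaptharishiSolomon2019, Claim 23 proof (arXiv p0011.txt:L22-24)] -/
theorem aeval_keepVar_pderiv (G : τ → S) (m : τ) (C' : MvPolynomial τ F) :
    aeval (fun i => if i = m then (Polynomial.X : Polynomial S) else Polynomial.C (G i))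
        (pderiv m C') =
      Polynomial.derivative
        (aeval (fun i => if i = m then (Polynomial.X : Polynomial S) else Polynomial.C (G i)) C') := by
  induction C' using MvPolynomial.induction_on with
  | C c =>
    rw [pderiv_C, map_zero, MvPolynomial.algHom_C, Polynomial.algebraMap_apply,
      Polynomial.derivative_C]
  | add p q hp hq => simp only [map_add, hp, hq]
  | mul_X p i hp =>
    rw [pderiv_mul, map_add, map_mul, map_mul, hp, map_mul, aeval_X, Polynomial.derivative_mul]
    by_cases him : i = m
    · subst him
      simp
    · rw [pderiv_X_of_ne him, map_zero, mul_zero, add_zero, if_neg him, Polynomial.derivative_C,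
        mul_zero, add_zero]

/-- Iterated form: `∂_{x_m^i}` becomes the `i`-th formal derivative of `Ĉ`.
[cite: GuoKumarSaptharishiSolomon2019, Claim 23 proof (arXiv p0011.txt:L30-40)] -/
theorem aeval_keepVar_pderiv_iterate (G : τ → S) (m : τ) (C' : MvPolynomial τ F) (i : ℕ) :
    aeval (fun i => if i = m then (Polynomial.X : Polynomial S) else Polynomial.C (G i))
        ((pderiv m)^[i] C') =
      Polynomial.derivative^[i]
        (aeval (fun i => if i = m then (Polynomial.X : Polynomial S) else Polynomial.C (G i)) C') := by
  induction i with
  | zero => rfl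
  | succ i ih =>
    rw [Function.iterate_succ_apply', Function.iterate_succ_apply', aeval_keepVar_pderiv, ih]

/-- `Ĉ(g_m) = C(g_0, …, g_m)`: evaluating the kept variable at `g_m` recovers `C ∘ G`.
[cite: GuoKumarSaptharishiSolomon2019, Claim 23 proof (arXiv p0011.txt:L30-34, "`Ĉ(g_n) = C ∘ G_P(z,y)`")] -/
theorem eval_aeval_keepVar (G : τ → S) (m : τ) (C' : MvPolynomial τ F) :
    Polynomial.eval (G m)
        (aeval (fun i => if i = m then (Polynomial.X : Polynomial S) else Polynomial.C (G i)) C') =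
      aeval G C' := by
  induction C' using MvPolynomial.induction_on with
  | C c =>
    rw [MvPolynomial.algHom_C, MvPolynomial.algHom_C, Polynomial.algebraMap_apply, Polynomial.eval_C]
  | add p q hp hq => rw [map_add, map_add, Polynomial.eval_add, hp, hq]
  | mul_X p i hp =>
    rw [map_mul, map_mul, Polynomial.eval_mul, hp, aeval_X, aeval_X]
    by_cases him : i = m
    · subst him; simp
    · rw [if_neg him, Polynomial.eval_C]

variable [IsDomain S] [CharZero S]

/-- **GKSS Claim 23 (Case 2).** "Let `r = deg_{x_n}(Ĉ)`. … Since `Ĉ(g_n) = C ∘ G_P(z,y) = 0` and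
`∂_{x_n^t}(Ĉ)(g_n) ≠ 0`, there must be an intermediate derivative where a switch from zero to
nonzero occurs. Hence, there must be some `i < r` such that `∂_{x_n^i}(C) ∘ G_P(z,y) = 0`,
`∂_{x_n^{i+1}}(C) ∘ G_P(z,y) ≠ 0`." Over any commutative domain `S ⊇ F` of characteristic zero and
any substitution `G`: if `C ∘ G = 0` and `Ĉ ≠ 0` then such an `i` exists — namely
`i + 1 = ` the multiplicity of the root `g_m` of `Ĉ` ("the largest `e` such that `(x_n - g_n)^e`
divides `Ĉ`"). [cite: GuoKumarSaptharishiSolomon2019, Claim 23 (arXiv p0011.txt:L14-40)] -/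
theorem claim23 (G : τ → S) (m : τ) (C' : MvPolynomial τ F) (hC : aeval G C' = 0)
    (hĈ : aeval (fun i => if i = m then (Polynomial.X : Polynomial S) else Polynomial.C (G i))
      C' ≠ 0) :
    ∃ i : ℕ, aeval G ((pderiv m)^[i] C') = 0 ∧ aeval G ((pderiv m)^[i + 1] C') ≠ 0 := by
  set Ĉ := aeval (fun i => if i = m then (Polynomial.X : Polynomial S) else Polynomial.C (G i)) C'
    with hĈdef
  have hroot : Ĉ.IsRoot (G m) := by
    rw [Polynomial.IsRoot, hĈdef, eval_aeval_keepVar, hC]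
  have hμ : 0 < Ĉ.rootMultiplicity (G m) := (Polynomial.rootMultiplicity_pos hĈ).mpr hroot
  refine ⟨Ĉ.rootMultiplicity (G m) - 1, ?_, ?_⟩
  · rw [← eval_aeval_keepVar G m, aeval_keepVar_pderiv_iterate, ← hĈdef]
    exact Polynomial.isRoot_iterate_derivative_of_lt_rootMultiplicity (by omega)
  · rw [Nat.sub_add_cancel hμ, ← eval_aeval_keepVar G m, aeval_keepVar_pderiv_iterate,
      ← hĈdef, Polynomial.eval_iterate_derivative_rootMultiplicity, nsmul_eq_mul]
    exact mul_ne_zero (Nat.cast_ne_zero.mpr (Nat.factorial_ne_zero _))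
      (Polynomial.eval_divByMonic_pow_rootMultiplicity_ne_zero _ hĈ)

end GKSS2019

end Literature.Computability.AlgebraicComplexity
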